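import Summits.BirchSwinnertonDyer.BirchSwinnertonDyer.Theorems.AlignedTransportAtTwoMainConjectureOfRankZeroBSDAtTwoCyclotomicLayerWeightBudget
import Summits.BirchSwinnertonDyer.BirchSwinnertonDyer.Theorems.AlignedTransportAtTwoMainConjectureOfRankZeroBSDAtTwoEisensteinRigidityLambdaThree
import HarnessLib

/-!
# Route `AlignedTransportAtTwo`, crux C2 `MainConjectureOfRankZeroBSDAtTwo` (stmt-BirchSwinnertonDyer-22298):
# THE MORDELL–WEIL PROFILE OF THE `a₂ = −1` ROAD — `λ₂ = 3`: NO growth above `ℚ(√2)`, `rank W(ℚ_m) ≤ 1` at every layer of the `2`-tower;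
# `ord_{T=−2} L₂ = 3`: at most ONE jump above `ℚ(√2)`, of size `λ₂ − 3 = 2ⁿ`, i.e. a jump forces `λ₂ = 2ⁿ + 3` (vs `2ⁿ + 1` on `a₂ = +1`)

HONEST FRAMING (cell `bsd-f1-sign2`, WIDTH-5 attached prover seat `bsd-line-att-p5` gen 37 on line `birth` of the lead `bsd-line-att-p2`;
`--supports` stmt-BirchSwinnertonDyer-22298, closes nothing; BSD is NOT proved by any of this; the crux C2, its verdict «blocked-on
`Rank1Residual.GreenbergMuConjectureIrreducible`» and every registered stub are untouched). THEOREMS ONLY — no `def`, no `sorry`, nothing asserted about any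
particular curve. PRINT binders: `h17` = Kato 2004 Thm. 17.4 (1)(2) AT `2` (`kato_divisibility_allPrimes W 2`); `hGZK` (Gross–Zagier–Kolyvagin, only to read
`rank W(ℚ) = 0` from `r_an = 0`). This is the lineage's successor item (g36 memo CYCLOTOMIC-LAYERS §13 (i)): g36's `…CyclotomicLayerRoadProfile` is the `a₂ = +1` road.

THE ROAD (`a₂ = −1` half): `W/ℚ` globally minimal, good ordinary at `2` with `a₂ = −1` (`#Ẽ(𝔽₂) = 4`), `∏ c_v` odd, `Δ_min ≡ 3, 5 (mod 8)`, `r_an = 0`, `f` its newform at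
level `N_W` with unit central symbol `‖[0]⁺_f‖₂ = 1`, `G` an integral lift of `L₂(f,α)` with `μ(G) = 0`. Then `‖G(0)‖₂ = 2⁻⁴`, `(T+2) ∣ G`, `λ(G)` odd, `ord_{T=−2} G ∈ {1,3}`
(g33–g35). The ENGINE (§0, pure `Λ`-algebra): for `G = (T+2)^k·M·H` with `H` irreducible and `M` free of layer primes above the first, a layer prime `Ψ_n = Φ_{2^{n+1}}(1+T)`
(`n ≥ 1`) dividing `G` must be `~ H`, so `λ(H) = 2ⁿ`, and `Ψ_n² ∤ G`; with g36's exact jump `rank W(ℚ_{n+1}) − rank W(ℚ_n) = 2ⁿ·c`, `Ψ_n^c ∣ G`, this gives the profile.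

* §0 `associated_of_cyclotomicLayer_dvd_shape`; `mordellWeilRank_layer_succ_eq_or_of_shape` (**one layer: stationary OR jump EXACTLY `2ⁿ = λ(H)`**);
  `mordellWeilRank_layer_eq_or_eq_add_of_shape` (**profile: `rank W(ℚ_m) ∈ {r₁, r₁ + λ(H)}`, at most one jump, in the layer `2ⁿ = λ(H)`**); any good ordinary `W`, PRINT `h17`.
* §1 ★★★ THE `λ₂ = 3` ROW (`a₂ = −1`; conductor 1187 and every such road curve): `G = (T+2)·H` with `‖H(0)‖₂ = ⅛` and `H` IRREDUCIBLE (g35, `T¹`-law), so `H` has the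
  degree `2 = λ(Φ₄(1+T))` but NOT the weight of a layer prime: `mordellWeilRank_layer_succ_eq_of_negRoad_of_lam_three` (**`rank W(ℚ_{n+1}) = rank W(ℚ_n)` ∀ `n ≥ 1`**),
  `mordellWeilRank_layer_le_one_of_negRoad_of_lam_three` (**`+ hGZK`: `rank W(ℚ_m) ≤ 1` at EVERY layer `m`** — the Mordell–Weil rank over the whole cyclotomic
  `ℤ₂`-tower is at most one), `not_layerRankGEAt_two_of_negRoad_of_lam_three` (**the certificate `LayerRankGEAt W 2 m 2` is REFUTED for every `m`**: g35's door
  «rank ≥ 2 somewhere ⟹ MC₂» is VOID on this row — its residual bit is pure Ш / fine-Selmer growth). Contrast: on the `a₂ = +1`, `λ₂ = 3` road the cofactor IS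
  `~ Φ₄(1+T)`-shaped (Greenberg's conductor-195 `(T+2)(T²+2T+2)`, p. 177) and `rank W(ℚ(ζ₁₆)⁺) = 3` is admissible (g36).
* §2 ★★ THE `ord_{T=−2} L₂ = 3` ROW: `G = (T+2)³·H`, `H` Eisenstein hence prime: `lam_eq_of_negRoad_ord_three_of_rank_jump`-type dichotomy
  `mordellWeilRank_layer_succ_eq_or_of_negRoad_ord_three` (**stationary OR jump `2ⁿ` with `λ₂ = 2ⁿ + 3`**), profile `mordellWeilRank_layer_eq_or_of_negRoad_ord_three`
  (**`rank W(ℚ_m) ∈ {r₁, r₁ + λ₂ − 3}`, `r₁ ≤ 3`**), `mordellWeilRank_layer_eq_layer_one_of_negRoad_ord_three_of_ne` (**`λ₂ − 3` not a power of two ⇒ stationary above `ℚ(√2)`**).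
  The `ι`-pair / split-pair rows (`ord = 1`, `λ₂ ≥ 5`) are the companion file `…CyclotomicLayerRoadMinusPairs`.

References: K. Kato, Astérisque 295 (2004), Thm. 17.4 [Kato2004Asterisque]; R. Greenberg, LNM 1716 (1999), Thm. 1.9 (p. 63), §5 pp. 132, 176–177, 181
[GreenbergLNM1716]; K. Matsuno, J. Number Theory 128 (2008) [Matsuno2008]; L. Washington, GTM 83, §7.1, §13.2 [Washington1997].
-/

set_option linter.dupNamespace false
set_option autoImplicit false

noncomputable section

open scoped Classical MatrixGroups ModularForm Polynomial

namespace Summit.BirchSwinnertonDyer.BirchSwinnertonDyer.Theorems.AlignedTransportAtTwoCyclotomicLayerRoadMinus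

open Polynomial CongruenceSubgroup WeierstrassCurve Literature.NumberTheory.EllipticCurves
  Literature.NumberTheory.EllipticCurves.ModularForms
  Literature.NumberTheory.EllipticCurves.Rank1Residual
  Literature.NumberTheory.EllipticCurves.Rank1Residual.Typed
  Literature.NumberTheory.EllipticCurves.Greenberg1999
  Summit.BirchSwinnertonDyer.Rank1Residual
  Summit.BirchSwinnertonDyer.Rank1Residual.X1.MuLambda
  Summit.BirchSwinnertonDyer.Rank1Residual.X1.ParitySqueeze
  Summit.BirchSwinnertonDyer.Rank1Residual.Iwasawa
  Summit.BirchSwinnertonDyer.Rank1Residual.F1Sign2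
  Summit.BirchSwinnertonDyer.BirchSwinnertonDyer.Theorems.AlignedTransportAtTwoSeed
  Summit.BirchSwinnertonDyer.BirchSwinnertonDyer.Theorems.AlignedTransportAtTwoTwoFixedPoints
  Summit.BirchSwinnertonDyer.BirchSwinnertonDyer.Theorems.AlignedTransportAtTwoRoadSecondFixedPoint
  Summit.BirchSwinnertonDyer.BirchSwinnertonDyer.Theorems.AlignedTransportAtTwoEisensteinRigidity
  Summit.BirchSwinnertonDyer.BirchSwinnertonDyer.Theorems.AlignedTransportAtTwoEisensteinRigidityConservation
  Summit.BirchSwinnertonDyer.BirchSwinnertonDyer.Theorems.AlignedTransportAtTwoEisensteinRigidityPrime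
  Summit.BirchSwinnertonDyer.BirchSwinnertonDyer.Theorems.AlignedTransportAtTwoEisensteinRigidityLambdaThree
  Summit.BirchSwinnertonDyer.BirchSwinnertonDyer.Theorems.AlignedTransportAtTwoLayerOneRankBound
  Summit.BirchSwinnertonDyer.BirchSwinnertonDyer.Theorems.AlignedTransportAtTwoCyclotomicLayerPrime
  Summit.BirchSwinnertonDyer.BirchSwinnertonDyer.Theorems.AlignedTransportAtTwoCyclotomicLayerRankDichotomy
  Summit.BirchSwinnertonDyer.BirchSwinnertonDyer.Theorems.AlignedTransportAtTwoCyclotomicLayerLFunction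
  Summit.BirchSwinnertonDyer.BirchSwinnertonDyer.Theorems.AlignedTransportAtTwoCyclotomicLayerRankJumpExact
  Summit.BirchSwinnertonDyer.BirchSwinnertonDyer.Theorems.AlignedTransportAtTwoCyclotomicLayerWeight
  Summit.BirchSwinnertonDyer.BirchSwinnertonDyer.Theorems.AlignedTransportAtTwoCyclotomicLayerWeightBudget
  Summit.BirchSwinnertonDyer.BirchSwinnertonDyer.Theorems.DefectPrime

/-! ## §0 The engine: `G = (T+2)^k·M·H`, `H` irreducible, `M` free of layer primes above the first -/

section Engine

/-- (pure `Λ`-algebra) **`Ψ_n ∣ (T+2)^k·M·H` (`n ≥ 1`), `Ψ_m ∤ M` for all `m ≥ 1`, `H` irreducible ⇒ `Ψ_n ~ H`, `λ(H) = 2ⁿ`, and `Ψ_n² ∤ (T+2)^k·M·H`.**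
[cite: Washington1997, §13.2] [cite: GreenbergLNM1716, §5 p. 177] -/
theorem associated_of_cyclotomicLayer_dvd_shape {k : ℕ} {M H : PowerSeries ℤ_[2]}
    (hM : ∀ m, 1 ≤ m → ¬ (((cyclotomic (2 ^ (m + 1)) ℤ_[2]).comp (X + 1) : ℤ_[2][X]) : PowerSeries ℤ_[2]) ∣ M) (hH : Irreducible H)
    {n : ℕ} (hn : 1 ≤ n)
    (h : (((cyclotomic (2 ^ (n + 1)) ℤ_[2]).comp (X + 1) : ℤ_[2][X]) : PowerSeries ℤ_[2]) ∣
      (PowerSeries.X + PowerSeries.C (2 : ℤ_[2])) ^ k * (M * H)) :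
    Associated ((((cyclotomic (2 ^ (n + 1)) ℤ_[2]).comp (X + 1) : ℤ_[2][X]) : PowerSeries ℤ_[2])) H ∧ lam H = 2 ^ n ∧
      ¬ (((cyclotomic (2 ^ (n + 1)) ℤ_[2]).comp (X + 1) : ℤ_[2][X]) : PowerSeries ℤ_[2]) ^ 2 ∣
        (PowerSeries.X + PowerSeries.C (2 : ℤ_[2])) ^ k * (M * H) := by
  have hΨ := prime_coe_cyclotomic_comp 2 n
  have h1 := cyclotomicLayer_dvd_of_dvd_X_add_C_two_pow_mul hn h
  have h2 : (((cyclotomic (2 ^ (n + 1)) ℤ_[2]).comp (X + 1) : ℤ_[2][X]) : PowerSeries ℤ_[2]) ∣ H := (hΨ.dvd_or_dvd h1).resolve_left (hM n hn)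
  refine ⟨associated_of_cyclotomicLayer_dvd_of_irreducible hH h2, ?_, ?_⟩
  · rw [(lam_mu_norm_of_cyclotomicLayer_dvd_of_irreducible hH h2).1]; simp
  · intro h3
    have h4 := hΨ.pow_dvd_of_dvd_mul_left 2 (not_cyclotomicLayer_dvd_X_add_C_two_pow hn k) h3
    exact not_cyclotomicLayer_sq_dvd_of_irreducible hH n (hΨ.pow_dvd_of_dvd_mul_left 2 (hM n hn) h4)

variable (V : WeierstrassCurve ℚ) [V.IsElliptic] [V.IsGloballyMinimal]

/-- ★★ **ONE LAYER FOR THE SHAPE `G = (T+2)^k·M·H` (`n ≥ 1`): `rank V(ℚ_{n+1}) = rank V(ℚ_n)`, OR (`rank V(ℚ_{n+1}) = rank V(ℚ_n) + 2ⁿ` EXACTLY ∧ `λ(H) = 2ⁿ`).**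
`V/ℚ` globally minimal, good ordinary at `2`, `f` a newform of `V` (any level) with PRINT `h17` at `2`; `G` an integral lift of `L₂(f,α)` of that shape with `H` irreducible and
`M` free of layer primes `Ψ_m`, `m ≥ 1`; `κ` the cyclotomic `ℤ₂`-extension with normalised generator. The exact jump is `2ⁿ·c` with `Ψ_n^c ∣ G` (g36), and `c ≤ 1` by §0.
[cite: Kato2004Asterisque, Thm. 17.4 (1)(2) (p. 273) and Thm. 18.4 (p. 281)] [cite: GreenbergLNM1716, §5 pp. 132 and 177] -/
theorem mordellWeilRank_layer_succ_eq_or_of_shape {N : ℕ} [NeZero N] {f : CuspForm (Gamma0 N) 2}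
    (h17 : kato_divisibility_allPrimes V 2 (f := f)) (hord : IsOrdinaryAt V 2) (hf : IsNewformOf V f)
    {G M H : IwasawaAlgebra 2} (hG : iwasawaToPowerSeries 2 G = padicLFunction f (unitRoot V 2 : ℚ_[2])) {k : ℕ}
    (hGMH : G = (PowerSeries.X + PowerSeries.C (2 : ℤ_[2])) ^ k * (M * H))
    (hM : ∀ m, 1 ≤ m → ¬ (((cyclotomic (2 ^ (m + 1)) ℤ_[2]).comp (X + 1) : ℤ_[2][X]) : PowerSeries ℤ_[2]) ∣ M) (hH : Irreducible H)
    {κ : ZpExtension ℚ 2} {γ : Field.absoluteGaloisGroup ℚ} (hκ : κ.IsCyclotomic) (hγ : κ.IsTopGenerator γ)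
    (hγ' : IsCyclotomicVariable 2 γ) {n : ℕ} (hn : 1 ≤ n) :
    (V.baseChange (κ.layer (n + 1))).mordellWeilRank = (V.baseChange (κ.layer n)).mordellWeilRank ∨
      ((V.baseChange (κ.layer (n + 1))).mordellWeilRank = (V.baseChange (κ.layer n)).mordellWeilRank + 2 ^ n ∧ lam H = 2 ^ n) := by
  obtain ⟨c, hdvd, hc⟩ := exists_cyclotomicLayer_pow_dvd_lift_and_mordellWeilRank_eq V h17 hord hf hG hκ hγ hγ' n
  -- restate in this file's elaboration of `rank V(ℚ_m)`
  have hc' : (V.baseChange (κ.layer (n + 1))).mordellWeilRank = (V.baseChange (κ.layer n)).mordellWeilRank + 2 ^ n * (2 - 1) * c := hc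
  rw [hGMH] at hdvd
  have hc1 : c ≤ 1 := by
    by_contra hlt
    exact (associated_of_cyclotomicLayer_dvd_shape hM hH hn (dvd_trans (dvd_pow_self _ (by omega)) hdvd)).2.2
      (dvd_trans (pow_dvd_pow _ (by omega)) hdvd)
  rcases Nat.le_one_iff_eq_zero_or_eq_one.mp hc1 with rfl | rfl
  · left; omega
  · right
    rw [pow_one] at hdvd
    exact ⟨by omega, (associated_of_cyclotomicLayer_dvd_shape hM hH hn hdvd).2.1⟩

/-- ★★ **THE PROFILE FOR THE SHAPE `G = (T+2)^k·M·H`**: for every `m ≥ 1`, **`rank V(ℚ_m) = rank V(ℚ₁)` OR (`rank V(ℚ_m) = rank V(ℚ₁) + λ(H)` ∧ `λ(H) = 2ⁿ`, `1 ≤ n < m`)**: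
above `ℚ(√2)` at most ONE jump, of size exactly `deg H`, in the layer `ℚ_{n+1}/ℚ_n` with `2ⁿ = λ(H)`. [cite: Kato2004Asterisque, Thm. 17.4 (1)(2) (p. 273)]
[cite: GreenbergLNM1716, Thm. 1.9 (p. 63) and §5 p. 177] -/
theorem mordellWeilRank_layer_eq_or_eq_add_of_shape {N : ℕ} [NeZero N] {f : CuspForm (Gamma0 N) 2}
    (h17 : kato_divisibility_allPrimes V 2 (f := f)) (hord : IsOrdinaryAt V 2) (hf : IsNewformOf V f)
    {G M H : IwasawaAlgebra 2} (hG : iwasawaToPowerSeries 2 G = padicLFunction f (unitRoot V 2 : ℚ_[2])) {k : ℕ}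
    (hGMH : G = (PowerSeries.X + PowerSeries.C (2 : ℤ_[2])) ^ k * (M * H))
    (hM : ∀ m, 1 ≤ m → ¬ (((cyclotomic (2 ^ (m + 1)) ℤ_[2]).comp (X + 1) : ℤ_[2][X]) : PowerSeries ℤ_[2]) ∣ M) (hH : Irreducible H)
    {κ : ZpExtension ℚ 2} {γ : Field.absoluteGaloisGroup ℚ} (hκ : κ.IsCyclotomic) (hγ : κ.IsTopGenerator γ)
    (hγ' : IsCyclotomicVariable 2 γ) {m : ℕ} (hm : 1 ≤ m) :
    (V.baseChange (κ.layer m)).mordellWeilRank = (V.baseChange (κ.layer 1)).mordellWeilRank ∨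
      ((V.baseChange (κ.layer m)).mordellWeilRank = (V.baseChange (κ.layer 1)).mordellWeilRank + lam H ∧
        ∃ n, 1 ≤ n ∧ n < m ∧ lam H = 2 ^ n) := by
  induction m, hm using Nat.le_induction with
  | base => exact Or.inl rfl
  | succ m hm ih =>
    rcases mordellWeilRank_layer_succ_eq_or_of_shape V h17 hord hf hG hGMH hM hH hκ hγ hγ' hm with hst | ⟨hjump, hlam⟩
    · rcases ih with h | ⟨h, n, hn1, hnm, hl⟩
      · exact Or.inl (hst.trans h)
      · exact Or.inr ⟨hst.trans h, n, hn1, Nat.lt_succ_of_lt hnm, hl⟩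
    · rcases ih with h | ⟨-, n, -, hnm, hl⟩
      · refine Or.inr ⟨?_, m, hm, Nat.lt_succ_self m, hlam⟩
        rw [hjump, h, hlam]
      · exfalso
        have h1 : 2 ^ n = 2 ^ m := by rw [← hl, hlam]
        exact (Nat.ne_of_lt hnm) (Nat.pow_right_injective le_rfl h1)

/-- **Shape `G = (T+2)^k·M·H` with `λ(H) ≠ 2ⁿ` for every `n ≥ 1` ⇒ `rank V(ℚ_m) = rank V(ℚ₁)` for every `m ≥ 1`.** [cite: Kato2004Asterisque, Thm. 17.4 (1)(2) (p. 273)]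
[cite: GreenbergLNM1716, §5 p. 177] -/
theorem mordellWeilRank_layer_eq_layer_one_of_shape_of_lam_ne {N : ℕ} [NeZero N] {f : CuspForm (Gamma0 N) 2}
    (h17 : kato_divisibility_allPrimes V 2 (f := f)) (hord : IsOrdinaryAt V 2) (hf : IsNewformOf V f)
    {G M H : IwasawaAlgebra 2} (hG : iwasawaToPowerSeries 2 G = padicLFunction f (unitRoot V 2 : ℚ_[2])) {k : ℕ}
    (hGMH : G = (PowerSeries.X + PowerSeries.C (2 : ℤ_[2])) ^ k * (M * H))
    (hM : ∀ m, 1 ≤ m → ¬ (((cyclotomic (2 ^ (m + 1)) ℤ_[2]).comp (X + 1) : ℤ_[2][X]) : PowerSeries ℤ_[2]) ∣ M) (hH : Irreducible H)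
    (hl : ∀ n, 1 ≤ n → lam H ≠ 2 ^ n)
    {κ : ZpExtension ℚ 2} {γ : Field.absoluteGaloisGroup ℚ} (hκ : κ.IsCyclotomic) (hγ : κ.IsTopGenerator γ)
    (hγ' : IsCyclotomicVariable 2 γ) {m : ℕ} (hm : 1 ≤ m) :
    (V.baseChange (κ.layer m)).mordellWeilRank = (V.baseChange (κ.layer 1)).mordellWeilRank := by
  rcases mordellWeilRank_layer_eq_or_eq_add_of_shape V h17 hord hf hG hGMH hM hH hκ hγ hγ' hm with h | ⟨-, n, hn1, -, hln⟩
  · exact h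
  · exact absurd hln (hl n hn1)

end Engine

/-! ## §1 The `λ₂ = 3` row of the `a₂ = −1` road: no Mordell–Weil growth above `ℚ(√2)`, `rank ≤ 1` along the whole `2`-tower -/

variable (W : WeierstrassCurve ℚ) [W.IsElliptic] [W.IsGloballyMinimal]

/-- **The cofactor of the `λ₂ = 3` row.** `W` globally minimal, good ordinary at `2`, `a₂ = −1`, `∏ c_v` odd, `Δ_min ≡ 3,5 (8)`, `r_an = 0`, unit central symbol, `G` an
integral lift with `μ(G) = 0` and `λ(G) = 3`: then `G = (T+2)·H` with `‖H(0)‖₂ = ⅛`, `H` IRREDUCIBLE (g35: `λ(H) = 2`, weight `3`, `‖H₁‖₂ ≤ ¼` by the `T¹`-law), and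
`ord_{T=−2} G = 1`. [cite: GreenbergLNM1716, §5 pp. 176–178 and 181] [cite: MazurTateTeitelbaum1986Invent, §I.17] -/
theorem exists_cofactor_of_negRoad_of_lam_three [NeZero (W.conductorNorm ℤ)] {f : CuspForm (Gamma0 (W.conductorNorm ℤ)) 2}
    (hord : IsOrdinaryAt W 2) (hf : IsNewformOf W f) (hr : W.analyticRank = 0) (ha : W.frobeniusTrace 2 = -1) (hodd : Odd W.tamagawaProduct)
    (hΔ : minimalDiscriminantInt W % 8 = 3 ∨ minimalDiscriminantInt W % 8 = 5)
    {G : IwasawaAlgebra 2} (hG : iwasawaToPowerSeries 2 G = padicLFunction f (unitRoot W 2 : ℚ_[2])) (hμ : mu G = 0) (hlam : lam G = 3)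
    (hsym : ‖(ratPlusSymbol f 0 : ℚ_[2])‖ = 1) :
    ∃ H : IwasawaAlgebra 2, G = (PowerSeries.X + PowerSeries.C (2 : ℤ_[2])) ^ 1 * H ∧ Irreducible H ∧
      ‖PowerSeries.constantCoeff H‖ = (2 : ℝ)⁻¹ ^ 3 ∧ HasOrderAtNegTwo G 1 := by
  have hX : Prime (PowerSeries.X + PowerSeries.C (2 : ℤ_[2]) : PowerSeries ℤ_[2]) := prime_X_add_C_two
  have hG0 : G ≠ 0 := by
    intro h0
    rw [h0, map_zero] at hG
    exact padicLFunction_unitRoot_ne_zero hord hf hG.symm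
  have hG1 : iwasawaToPowerSeries 2 G = PowerSeries.C (1 : ℚ_[2]) * padicLFunction f (unitRoot W 2 : ℚ_[2]) := by
    rw [map_one, one_mul]; exact hG
  obtain ⟨H, hGH⟩ := X_add_C_two_dvd_of_road hord hf hodd hΔ hr hG1
  -- `ord_{T=−2} G = 1`: it is `1` or `3`, and `ord + 2 ≤ λ(G) = 3`
  obtain ⟨n, hn⟩ := exists_hasOrderAtNegTwo hG0
  have hnle := orderAtNegTwo_add_two_le_lam_integralLift_of_road hord hf hodd hΔ hr hG hμ hsym hn
  have hn13 := orderAtNegTwo_eq_one_or_three_of_road_of_frobeniusTrace_eq_neg_one hord hf ha hodd hΔ hr hG hsym hn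
  have hn1 : n = 1 := by omega
  subst hn1
  -- the cofactor
  have hH0 : H ≠ 0 := by rintro rfl; exact hG0 (by rw [hGH, mul_zero])
  have hμH : mu H = 0 := by
    have h1 := mu_mul hX.ne_zero hH0
    rw [← hGH, hμ, mu_X_add_C_two_and_pfree.1] at h1
    omega
  have hlH : lam H = 2 := by
    have h1 := lam_mul hX.ne_zero hH0
    rw [← hGH, hlam, lam_X_add_C_two] at h1
    omega
  obtain ⟨hHn, hH1⟩ := norm_cofactor_of_frobeniusTrace_eq_neg_one W hord hf hr ha hG hGH hsym
  exact ⟨H, by rw [pow_one]; exact hGH, irreducible_of_lam_two_of_weight_three hμH hlH hHn hH1, hHn, hn⟩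

/-- ★★★ **THE `λ₂ = 3` ROW OF THE `a₂ = −1` ROAD HAS NO MORDELL–WEIL GROWTH ABOVE `ℚ(√2)`: `rank W(ℚ_{n+1}) = rank W(ℚ_n)` for every `n ≥ 1`.** `W/ℚ` globally minimal,
good ordinary at `2` with `a₂ = −1`, `∏ c_v` odd, `Δ_min ≡ 3, 5 (mod 8)`, `r_an = 0`; `f` its newform at level `N_W` with `‖[0]⁺_f‖₂ = 1`; `G` an integral lift of `L₂(f,α)` with
`μ(G) = 0` and **`λ(G) = 3`**; PRINT `h17`; `κ` the cyclotomic `ℤ₂`-extension with normalised generator `γ`. The cofactor `H` of `T+2` is irreducible of WEIGHT `3`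
(`‖H(0)‖₂ = ⅛`), so no layer prime `Φ_{2^{n+1}}(1+T)` (weight one) is `~ H`: growth at a layer `n+1 ≥ 2` is impossible (the weight, not the degree, forbids the conductor-195
mechanism here). [cite: Kato2004Asterisque, Thm. 17.4 (1)(2) (p. 273)] [cite: GreenbergLNM1716, §5 pp. 176–177 and 181] -/
theorem mordellWeilRank_layer_succ_eq_of_negRoad_of_lam_three [NeZero (W.conductorNorm ℤ)] {f : CuspForm (Gamma0 (W.conductorNorm ℤ)) 2}
    (h17 : kato_divisibility_allPrimes W 2 (f := f)) (hord : IsOrdinaryAt W 2) (hf : IsNewformOf W f) (hr : W.analyticRank = 0)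
    (ha : W.frobeniusTrace 2 = -1) (hodd : Odd W.tamagawaProduct) (hΔ : minimalDiscriminantInt W % 8 = 3 ∨ minimalDiscriminantInt W % 8 = 5)
    {G : IwasawaAlgebra 2} (hG : iwasawaToPowerSeries 2 G = padicLFunction f (unitRoot W 2 : ℚ_[2])) (hμ : mu G = 0) (hlam : lam G = 3)
    (hsym : ‖(ratPlusSymbol f 0 : ℚ_[2])‖ = 1)
    {κ : ZpExtension ℚ 2} {γ : Field.absoluteGaloisGroup ℚ} (hκ : κ.IsCyclotomic) (hγ : κ.IsTopGenerator γ)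
    (hγ' : IsCyclotomicVariable 2 γ) {n : ℕ} (hn : 1 ≤ n) :
    (W.baseChange (κ.layer (n + 1))).mordellWeilRank = (W.baseChange (κ.layer n)).mordellWeilRank := by
  obtain ⟨H, hGH, hirr, hHn, -⟩ := exists_cofactor_of_negRoad_of_lam_three W hord hf hr ha hodd hΔ hG hμ hlam hsym
  have hw : ‖PowerSeries.constantCoeff H‖ ≠ (2 : ℝ)⁻¹ := by rw [hHn]; norm_num
  exact mordellWeilRank_layer_succ_eq_of_primeCofactor_of_norm_ne W h17 hord hf hG hGH hirr hw hκ hγ hγ' hn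

/-- **… so `rank W(ℚ_m) = rank W(ℚ₁)` for every `m ≥ 1` on the `λ₂ = 3` row of the `a₂ = −1` road**: the Mordell–Weil rank of `W` over `ℚ_∞ = ⋃ ℚ(ζ_{2^{m+2}})⁺` is reached
at `ℚ(√2)`. [cite: Kato2004Asterisque, Thm. 17.4 (1)(2) (p. 273)] [cite: GreenbergLNM1716, Thm. 1.9 (p. 63)] -/
theorem mordellWeilRank_layer_eq_layer_one_of_negRoad_of_lam_three [NeZero (W.conductorNorm ℤ)] {f : CuspForm (Gamma0 (W.conductorNorm ℤ)) 2}
    (h17 : kato_divisibility_allPrimes W 2 (f := f)) (hord : IsOrdinaryAt W 2) (hf : IsNewformOf W f) (hr : W.analyticRank = 0)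
    (ha : W.frobeniusTrace 2 = -1) (hodd : Odd W.tamagawaProduct) (hΔ : minimalDiscriminantInt W % 8 = 3 ∨ minimalDiscriminantInt W % 8 = 5)
    {G : IwasawaAlgebra 2} (hG : iwasawaToPowerSeries 2 G = padicLFunction f (unitRoot W 2 : ℚ_[2])) (hμ : mu G = 0) (hlam : lam G = 3)
    (hsym : ‖(ratPlusSymbol f 0 : ℚ_[2])‖ = 1)
    {κ : ZpExtension ℚ 2} {γ : Field.absoluteGaloisGroup ℚ} (hκ : κ.IsCyclotomic) (hγ : κ.IsTopGenerator γ)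
    (hγ' : IsCyclotomicVariable 2 γ) {m : ℕ} (hm : 1 ≤ m) :
    (W.baseChange (κ.layer m)).mordellWeilRank = (W.baseChange (κ.layer 1)).mordellWeilRank := by
  induction m, hm using Nat.le_induction with
  | base => rfl
  | succ m hm ih => rw [mordellWeilRank_layer_succ_eq_of_negRoad_of_lam_three W h17 hord hf hr ha hodd hΔ hG hμ hlam hsym hκ hγ hγ' hm, ih]

/-- ★★★ **`+ hGZK`: ON THE `λ₂ = 3` ROW OF THE `a₂ = −1` ROAD, `rank W(ℚ_m) ≤ 1` AT EVERY LAYER `m` OF THE CYCLOTOMIC `ℤ₂`-TOWER** (`rank W(ℚ) = 0` by GZK,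
`rank W(ℚ₁) ≤ 0 + ord_{T=−2} L₂ = 1` by the second-fixed-point bound (g34), no growth above by the weight obstruction, and `rank W(ℚ_0) ≤ rank W(ℚ₁)`). The single Mordell–Weil
point the tower can ever acquire is the one predicted at `ℚ(√2)` by `w(W ⊗ χ₈) = −1`. [cite: Kato2004Asterisque, Thm. 17.4 (1)(2) (p. 273)] [cite: GreenbergLNM1716, §5 pp. 176 and 181] -/
theorem mordellWeilRank_layer_le_one_of_negRoad_of_lam_three [NeZero (W.conductorNorm ℤ)] {f : CuspForm (Gamma0 (W.conductorNorm ℤ)) 2}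
    (h17 : kato_divisibility_allPrimes W 2 (f := f)) (hGZK : rank_eq_analyticRank_of_analyticRank_le_one)
    (hord : IsOrdinaryAt W 2) (hf : IsNewformOf W f) (hr : W.analyticRank = 0)
    (ha : W.frobeniusTrace 2 = -1) (hodd : Odd W.tamagawaProduct) (hΔ : minimalDiscriminantInt W % 8 = 3 ∨ minimalDiscriminantInt W % 8 = 5)
    {G : IwasawaAlgebra 2} (hG : iwasawaToPowerSeries 2 G = padicLFunction f (unitRoot W 2 : ℚ_[2])) (hμ : mu G = 0) (hlam : lam G = 3)
    (hsym : ‖(ratPlusSymbol f 0 : ℚ_[2])‖ = 1)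
    {κ : ZpExtension ℚ 2} {γ : Field.absoluteGaloisGroup ℚ} (hκ : κ.IsCyclotomic) (hγ : κ.IsTopGenerator γ)
    (hγ' : IsCyclotomicVariable 2 γ) (m : ℕ) : (W.baseChange (κ.layer m)).mordellWeilRank ≤ 1 := by
  obtain ⟨H, -, -, -, h1⟩ := exists_cofactor_of_negRoad_of_lam_three W hord hf hr ha hodd hΔ hG hμ hlam hsym
  have hrk : W.mordellWeilRank = 0 := by rw [(hGZK W (by rw [hr]; exact zero_le_one)).1, hr]
  have hle1 : (W.baseChange (κ.layer 1)).mordellWeilRank ≤ W.mordellWeilRank + 1 :=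
    mordellWeilRank_layer_one_le_add_orderAtNegTwo W h17 hord hf hG h1 hκ hγ hγ'
  rcases Nat.eq_zero_or_pos m with rfl | hm
  · have h01 : (W.baseChange (κ.layer 0)).mordellWeilRank ≤ (W.baseChange (κ.layer (0 + 1))).mordellWeilRank :=
      mordellWeilRank_layer_le_succ W κ 0
    have h01' : (W.baseChange (κ.layer 0)).mordellWeilRank ≤ (W.baseChange (κ.layer 1)).mordellWeilRank := h01
    omega
  · have h := mordellWeilRank_layer_eq_layer_one_of_negRoad_of_lam_three W h17 hord hf hr ha hodd hΔ hG hμ hlam hsym hκ hγ hγ' hm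
    omega

/-- ★ **THE RANK-TWO-SOMEWHERE CERTIFICATE IS REFUTED ON THE `λ₂ = 3` ROW OF THE `a₂ = −1` ROAD: `¬ Iwasawa.LayerRankGEAt W 2 m 2` for every `m`** (read at the normalised
cyclotomic datum, which exists). So g35's door `mazurMainConjecture_two_of_road_of_lam_three_of_layerRankGEAt_two` («rank ≥ 2 at some layer ⟹ MC₂(W)») can never fire here —
the one residual bit of this row is pure Ш / fine-Selmer growth, invisible to Mordell–Weil. [cite: Kato2004Asterisque, Thm. 17.4 (1)(2) (p. 273)] [cite: GreenbergLNM1716, §5 p. 176] -/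
theorem not_layerRankGEAt_two_of_negRoad_of_lam_three [NeZero (W.conductorNorm ℤ)] {f : CuspForm (Gamma0 (W.conductorNorm ℤ)) 2}
    (h17 : kato_divisibility_allPrimes W 2 (f := f)) (hGZK : rank_eq_analyticRank_of_analyticRank_le_one)
    (hord : IsOrdinaryAt W 2) (hf : IsNewformOf W f) (hr : W.analyticRank = 0)
    (ha : W.frobeniusTrace 2 = -1) (hodd : Odd W.tamagawaProduct) (hΔ : minimalDiscriminantInt W % 8 = 3 ∨ minimalDiscriminantInt W % 8 = 5)
    {G : IwasawaAlgebra 2} (hG : iwasawaToPowerSeries 2 G = padicLFunction f (unitRoot W 2 : ℚ_[2])) (hμ : mu G = 0) (hlam : lam G = 3)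
    (hsym : ‖(ratPlusSymbol f 0 : ℚ_[2])‖ = 1) (m : ℕ) : ¬ LayerRankGEAt W 2 m 2 := by
  intro h
  obtain ⟨κ, hκ, γ, hγ, hγ'⟩ := exists_isCyclotomic_isTopGenerator_isCyclotomicVariable_holds 2
  have h2 : 2 ≤ (W.baseChange (κ.layer m)).mordellWeilRank := h κ hκ
  have h1 := mordellWeilRank_layer_le_one_of_negRoad_of_lam_three W h17 hGZK hord hf hr ha hodd hΔ hG hμ hlam hsym hκ hγ hγ' m
  omega

/-! ## §2 The `ord_{T=−2} L₂ = 3` row of the `a₂ = −1` road: at most one jump above `ℚ(√2)`, forcing `λ₂ = 2ⁿ + 3` -/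

/-- **The cofactor of the `ord₋₂ = 3` row.** `a₂ = −1`, unit symbol, `ord_{T=−2} G = 3`: `G = (T+2)³·H` with `‖H(0)‖₂ = ½` (`‖G(0)‖₂ = 2⁻⁴`), so `H` is Eisenstein, PRIME and
irreducible in `Λ` (g35 `prime_of_norm_constantCoeff_eq_half`), and `λ(G) = 3 + λ(H)`. [cite: Washington1997, §7.1] [cite: GreenbergLNM1716, §5 p. 176] -/
theorem exists_cofactor_of_negRoad_ord_three [NeZero (W.conductorNorm ℤ)] {f : CuspForm (Gamma0 (W.conductorNorm ℤ)) 2}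
    (hord : IsOrdinaryAt W 2) (hf : IsNewformOf W f) (ha : W.frobeniusTrace 2 = -1)
    {G : IwasawaAlgebra 2} (hG : iwasawaToPowerSeries 2 G = padicLFunction f (unitRoot W 2 : ℚ_[2])) (h3 : HasOrderAtNegTwo G 3)
    (hsym : ‖(ratPlusSymbol f 0 : ℚ_[2])‖ = 1) :
    ∃ H : IwasawaAlgebra 2, G = (PowerSeries.X + PowerSeries.C (2 : ℤ_[2])) ^ 3 * (1 * H) ∧ Irreducible H ∧
      ‖PowerSeries.constantCoeff H‖ = (2 : ℝ)⁻¹ ∧ lam G = 3 + lam H := by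
  have hX : Prime (PowerSeries.X + PowerSeries.C (2 : ℤ_[2]) : PowerSeries ℤ_[2]) := prime_X_add_C_two
  have hG0 : G ≠ 0 := by
    intro h0
    rw [h0, map_zero] at hG
    exact padicLFunction_unitRoot_ne_zero hord hf hG.symm
  obtain ⟨H, hGH⟩ := h3.1
  have hH0 : H ≠ 0 := by rintro rfl; exact hG0 (by rw [hGH, mul_zero])
  have hGn : ‖PowerSeries.constantCoeff G‖ = (2 : ℝ)⁻¹ ^ (3 + 1) := norm_constantCoeff_lift_of_frobeniusTrace_eq_neg_one W hord hf ha hG hsym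
  have hHn : ‖PowerSeries.constantCoeff H‖ = (2 : ℝ)⁻¹ := by
    have h1 : ‖PowerSeries.constantCoeff G‖ = (2 : ℝ)⁻¹ ^ 3 * ‖PowerSeries.constantCoeff H‖ := by
      rw [hGH, map_mul, norm_mul, norm_constantCoeff_X_add_C_two_pow]
    rw [hGn, pow_succ] at h1
    exact (mul_left_cancel₀ (by positivity) h1).symm
  have hlamG : lam G = 3 + lam H := by
    rw [hGH, lam_mul (pow_ne_zero _ hX.ne_zero) hH0, lam_X_add_C_two_pow]
  exact ⟨H, by rw [one_mul]; exact hGH, (prime_of_norm_constantCoeff_eq_half hHn).irreducible, hHn, hlamG⟩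

/-- ★★ **ONE LAYER OF THE `ord₋₂ = 3` ROW (`n ≥ 1`): `rank W(ℚ_{n+1}) = rank W(ℚ_n)`, OR (`rank W(ℚ_{n+1}) = rank W(ℚ_n) + 2ⁿ` ∧ `λ(G) = 2ⁿ + 3`).** `W/ℚ` globally minimal, good
ordinary at `2` with `a₂ = −1`, `f` its newform at level `N_W` with `‖[0]⁺_f‖₂ = 1`, `G` an integral lift with `ord_{T=−2} G = 3`; PRINT `h17`. A jump above `ℚ(√2)` is carried by
the Eisenstein cofactor `H ~ Φ_{2^{n+1}}(1+T)` of `(T+2)³`, so `λ₂ − 3 = λ(H) = 2ⁿ` (vs `λ₂ − 1 = 2ⁿ` on the `a₂ = +1` road). [cite: Kato2004Asterisque, Thm. 17.4 (1)(2) (p. 273)]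
[cite: GreenbergLNM1716, §5 pp. 177 and 181] -/
theorem mordellWeilRank_layer_succ_eq_or_of_negRoad_ord_three [NeZero (W.conductorNorm ℤ)] {f : CuspForm (Gamma0 (W.conductorNorm ℤ)) 2}
    (h17 : kato_divisibility_allPrimes W 2 (f := f)) (hord : IsOrdinaryAt W 2) (hf : IsNewformOf W f) (ha : W.frobeniusTrace 2 = -1)
    {G : IwasawaAlgebra 2} (hG : iwasawaToPowerSeries 2 G = padicLFunction f (unitRoot W 2 : ℚ_[2])) (h3 : HasOrderAtNegTwo G 3)
    (hsym : ‖(ratPlusSymbol f 0 : ℚ_[2])‖ = 1)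
    {κ : ZpExtension ℚ 2} {γ : Field.absoluteGaloisGroup ℚ} (hκ : κ.IsCyclotomic) (hγ : κ.IsTopGenerator γ)
    (hγ' : IsCyclotomicVariable 2 γ) {n : ℕ} (hn : 1 ≤ n) :
    (W.baseChange (κ.layer (n + 1))).mordellWeilRank = (W.baseChange (κ.layer n)).mordellWeilRank ∨
      ((W.baseChange (κ.layer (n + 1))).mordellWeilRank = (W.baseChange (κ.layer n)).mordellWeilRank + 2 ^ n ∧ lam G = 2 ^ n + 3) := by
  obtain ⟨H, hGH, hirr, -, hlamG⟩ := exists_cofactor_of_negRoad_ord_three W hord hf ha hG h3 hsym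
  have hM : ∀ m, 1 ≤ m → ¬ (((cyclotomic (2 ^ (m + 1)) ℤ_[2]).comp (X + 1) : ℤ_[2][X]) : PowerSeries ℤ_[2]) ∣ (1 : IwasawaAlgebra 2) :=
    fun m _ h ↦ (prime_coe_cyclotomic_comp 2 m).not_unit (isUnit_of_dvd_one h)
  rcases mordellWeilRank_layer_succ_eq_or_of_shape W h17 hord hf hG hGH hM hirr hκ hγ hγ' hn with h | ⟨h, hl⟩
  · exact Or.inl h
  · exact Or.inr ⟨h, by rw [hlamG, hl, add_comm]⟩

/-- ★★ **THE PROFILE OF THE `ord₋₂ = 3` ROW**: for every `m ≥ 1`, **`rank W(ℚ_m) = rank W(ℚ₁)` OR (`rank W(ℚ_m) = rank W(ℚ₁) + (λ(G) − 3)` ∧ `λ(G) = 2ⁿ + 3`, `1 ≤ n < m`)** — at most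
ONE jump above `ℚ(√2)`, of size exactly `λ₂ − 3`, in the layer with `2ⁿ = λ₂ − 3`. [cite: Kato2004Asterisque, Thm. 17.4 (1)(2) (p. 273)] [cite: GreenbergLNM1716, Thm. 1.9 (p. 63) and §5 p. 177] -/
theorem mordellWeilRank_layer_eq_or_of_negRoad_ord_three [NeZero (W.conductorNorm ℤ)] {f : CuspForm (Gamma0 (W.conductorNorm ℤ)) 2}
    (h17 : kato_divisibility_allPrimes W 2 (f := f)) (hord : IsOrdinaryAt W 2) (hf : IsNewformOf W f) (ha : W.frobeniusTrace 2 = -1)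
    {G : IwasawaAlgebra 2} (hG : iwasawaToPowerSeries 2 G = padicLFunction f (unitRoot W 2 : ℚ_[2])) (h3 : HasOrderAtNegTwo G 3)
    (hsym : ‖(ratPlusSymbol f 0 : ℚ_[2])‖ = 1)
    {κ : ZpExtension ℚ 2} {γ : Field.absoluteGaloisGroup ℚ} (hκ : κ.IsCyclotomic) (hγ : κ.IsTopGenerator γ)
    (hγ' : IsCyclotomicVariable 2 γ) {m : ℕ} (hm : 1 ≤ m) :
    (W.baseChange (κ.layer m)).mordellWeilRank = (W.baseChange (κ.layer 1)).mordellWeilRank ∨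
      ((W.baseChange (κ.layer m)).mordellWeilRank = (W.baseChange (κ.layer 1)).mordellWeilRank + (lam G - 3) ∧
        ∃ n, 1 ≤ n ∧ n < m ∧ lam G = 2 ^ n + 3) := by
  obtain ⟨H, hGH, hirr, -, hlamG⟩ := exists_cofactor_of_negRoad_ord_three W hord hf ha hG h3 hsym
  have hM : ∀ m, 1 ≤ m → ¬ (((cyclotomic (2 ^ (m + 1)) ℤ_[2]).comp (X + 1) : ℤ_[2][X]) : PowerSeries ℤ_[2]) ∣ (1 : IwasawaAlgebra 2) :=
    fun m _ h ↦ (prime_coe_cyclotomic_comp 2 m).not_unit (isUnit_of_dvd_one h)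
  rcases mordellWeilRank_layer_eq_or_eq_add_of_shape W h17 hord hf hG hGH hM hirr hκ hγ hγ' hm with h | ⟨h, n, hn1, hnm, hl⟩
  · exact Or.inl h
  · refine Or.inr ⟨by rw [h, hlamG, Nat.add_sub_cancel_left], n, hn1, hnm, by rw [hlamG, hl, add_comm]⟩

/-- **`+ hGZK`: on the `ord₋₂ = 3` row, at every layer `m ≥ 1`: `rank W(ℚ_m) ≤ 3` OR `λ₂ − 3 ≤ rank W(ℚ_m) ≤ λ₂`** (`rank W(ℚ) = 0`, `rank W(ℚ₁) ≤ 3` by the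
second-fixed-point bound). [cite: Kato2004Asterisque, Thm. 17.4 (1)(2) (p. 273)] [cite: GreenbergLNM1716, §5 p. 181] -/
theorem mordellWeilRank_layer_le_three_or_of_negRoad_ord_three [NeZero (W.conductorNorm ℤ)] {f : CuspForm (Gamma0 (W.conductorNorm ℤ)) 2}
    (h17 : kato_divisibility_allPrimes W 2 (f := f)) (hGZK : rank_eq_analyticRank_of_analyticRank_le_one)
    (hord : IsOrdinaryAt W 2) (hf : IsNewformOf W f) (hr : W.analyticRank = 0) (ha : W.frobeniusTrace 2 = -1)
    {G : IwasawaAlgebra 2} (hG : iwasawaToPowerSeries 2 G = padicLFunction f (unitRoot W 2 : ℚ_[2])) (h3 : HasOrderAtNegTwo G 3)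
    (hsym : ‖(ratPlusSymbol f 0 : ℚ_[2])‖ = 1)
    {κ : ZpExtension ℚ 2} {γ : Field.absoluteGaloisGroup ℚ} (hκ : κ.IsCyclotomic) (hγ : κ.IsTopGenerator γ)
    (hγ' : IsCyclotomicVariable 2 γ) {m : ℕ} (hm : 1 ≤ m) :
    (W.baseChange (κ.layer m)).mordellWeilRank ≤ 3 ∨
      (lam G - 3 ≤ (W.baseChange (κ.layer m)).mordellWeilRank ∧ (W.baseChange (κ.layer m)).mordellWeilRank ≤ lam G) := by
  have hrk : W.mordellWeilRank = 0 := by rw [(hGZK W (by rw [hr]; exact zero_le_one)).1, hr]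
  have hle1 : (W.baseChange (κ.layer 1)).mordellWeilRank ≤ W.mordellWeilRank + 3 :=
    mordellWeilRank_layer_one_le_add_orderAtNegTwo W h17 hord hf hG h3 hκ hγ hγ'
  rcases mordellWeilRank_layer_eq_or_of_negRoad_ord_three W h17 hord hf ha hG h3 hsym hκ hγ hγ' hm with h | ⟨h, n, -, -, hl⟩
  · left; omega
  · right
    have h2n : 1 ≤ 2 ^ n := Nat.one_le_two_pow
    constructor <;> omega

/-- ★ **`λ₂ − 3` NOT A POWER OF TWO (`2ⁿ`, `n ≥ 1`) ⇒ STATIONARY ABOVE `ℚ(√2)` on the `ord₋₂ = 3` row**: `rank W(ℚ_m) = rank W(ℚ₁)` (`≤ 3` with `hGZK`) for every `m ≥ 1`.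
[cite: Kato2004Asterisque, Thm. 17.4 (1)(2) (p. 273)] [cite: GreenbergLNM1716, §5 p. 177] -/
theorem mordellWeilRank_layer_eq_layer_one_of_negRoad_ord_three_of_ne [NeZero (W.conductorNorm ℤ)] {f : CuspForm (Gamma0 (W.conductorNorm ℤ)) 2}
    (h17 : kato_divisibility_allPrimes W 2 (f := f)) (hord : IsOrdinaryAt W 2) (hf : IsNewformOf W f) (ha : W.frobeniusTrace 2 = -1)
    {G : IwasawaAlgebra 2} (hG : iwasawaToPowerSeries 2 G = padicLFunction f (unitRoot W 2 : ℚ_[2])) (h3 : HasOrderAtNegTwo G 3)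
    (hsym : ‖(ratPlusSymbol f 0 : ℚ_[2])‖ = 1) (hne : ∀ n, 1 ≤ n → lam G ≠ 2 ^ n + 3)
    {κ : ZpExtension ℚ 2} {γ : Field.absoluteGaloisGroup ℚ} (hκ : κ.IsCyclotomic) (hγ : κ.IsTopGenerator γ)
    (hγ' : IsCyclotomicVariable 2 γ) {m : ℕ} (hm : 1 ≤ m) :
    (W.baseChange (κ.layer m)).mordellWeilRank = (W.baseChange (κ.layer 1)).mordellWeilRank := by
  rcases mordellWeilRank_layer_eq_or_of_negRoad_ord_three W h17 hord hf ha hG h3 hsym hκ hγ hγ' hm with h | ⟨-, n, hn1, -, hl⟩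
  · exact h
  · exact absurd hl (hne n hn1)

end Summit.BirchSwinnertonDyer.BirchSwinnertonDyer.Theorems.AlignedTransportAtTwoCyclotomicLayerRoadMinus
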